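import Mathlib.MeasureTheory.Group.Prod
import Mathlib.MeasureTheory.Measure.Lebesgue.Basic
import Mathlib.MeasureTheory.Measure.Haar.OfBasis
import Mathlib.Analysis.SpecialFunctions.Trigonometric.Basic
import HarnessLib

/-!
# Slicing planar sublevel sets over boxes: axis slices and diagonal slices

Topic `Literature/Analysis/Fourier`; the two-dimensional bookkeeping that turns one-dimensional
sublevel estimates (`SublevelSetEstimate.lean`) along a family of parallel lines into a bound for
the planar sublevel set `{|f| < s}` inside a box `(a, a+h] × (b, b+h]`:

* `volume_sublevel_box_le_fst` — slices `θ ↦ f(θ, φ)` (Fubini, `Measure.prod_apply_symm`);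
* `volume_sublevel_box_le_snd` — slices `φ ↦ f(θ, φ)` (`Measure.prod_apply`);
* `volume_sublevel_box_le_diag` — diagonal slices `u ↦ f(w + u, u)` (the shear
  `(w, u) ↦ (w + u, u)` preserves Lebesgue measure, `measurePreserving_add_prod`; the box meets the
  line `θ - φ = w` only for `w` in an interval of length `2h`);
* `exists_mem_Ioc_grid` — the grid `(-π + ih, -π + (i+1)h]`, `i < N`, covers `(-π, π]` once
  `N h ≥ 2π`.

Everything is proved. [folklore]
-/

noncomputable section

open Real Set MeasureTheory MeasureTheory.Measure

namespace Literature.Analysis.Fourier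

/-- The planar sublevel set of a continuous function inside a box is measurable. [folklore] -/
theorem measurableSet_sublevel_box {f : ℝ × ℝ → ℝ} (hf : Continuous f) (s a b h : ℝ) :
    MeasurableSet ({z : ℝ × ℝ | |f z| < s} ∩ Ioc a (a + h) ×ˢ Ioc b (b + h)) :=
  (isOpen_lt (continuous_abs.comp hf) continuous_const).measurableSet.inter
    (measurableSet_Ioc.prod measurableSet_Ioc)

/-- **Slicing along the first coordinate**: if every slice `θ ↦ f(θ, φ)`, `φ ∈ (b, b+h]`, has
sublevel set of measure `≤ W` in `(a, a+h]`, the planar sublevel set in the box has measure `≤ W h`.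
[folklore] -/
theorem volume_sublevel_box_le_fst {f : ℝ × ℝ → ℝ} (hf : Continuous f) {a b h s W : ℝ} (hW : 0 ≤ W)
    (hslice : ∀ φ ∈ Ioc b (b + h), volume {θ ∈ Ioc a (a + h) | |f (θ, φ)| < s} ≤ ENNReal.ofReal W) :
    volume ({z : ℝ × ℝ | |f z| < s} ∩ Ioc a (a + h) ×ˢ Ioc b (b + h)) ≤ ENNReal.ofReal (W * h) := by
  have hT := measurableSet_sublevel_box hf s a b h
  rw [show (volume : Measure (ℝ × ℝ)) = (volume : Measure ℝ).prod volume from rfl,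
    Measure.prod_apply_symm hT]
  have hpt : ∀ φ : ℝ, volume ((fun θ : ℝ => (θ, φ)) ⁻¹' ({z : ℝ × ℝ | |f z| < s} ∩ Ioc a (a + h) ×ˢ Ioc b (b + h))) ≤
      (Ioc b (b + h)).indicator (fun _ => ENNReal.ofReal W) φ := by
    intro φ
    by_cases hφ : φ ∈ Ioc b (b + h)
    · rw [indicator_of_mem hφ]
      refine le_trans (measure_mono fun θ hθ => ?_) (hslice φ hφ)
      simp only [mem_preimage, mem_inter_iff, mem_setOf_eq, mem_prod] at hθ
      exact ⟨hθ.2.1, hθ.1⟩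
    · rw [indicator_of_notMem hφ]
      have : (fun θ : ℝ => (θ, φ)) ⁻¹' ({z : ℝ × ℝ | |f z| < s} ∩ Ioc a (a + h) ×ˢ Ioc b (b + h)) = ∅ := by
        ext θ
        simp only [mem_preimage, mem_inter_iff, mem_setOf_eq, mem_prod, mem_empty_iff_false, iff_false, not_and]
        exact fun _ _ => hφ
      rw [this, measure_empty]
  calc ∫⁻ φ, volume ((fun θ : ℝ => (θ, φ)) ⁻¹' ({z : ℝ × ℝ | |f z| < s} ∩ Ioc a (a + h) ×ˢ Ioc b (b + h)))
      ≤ ∫⁻ φ, (Ioc b (b + h)).indicator (fun _ => ENNReal.ofReal W) φ := lintegral_mono hpt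
    _ = ENNReal.ofReal W * volume (Ioc b (b + h)) := lintegral_indicator_const measurableSet_Ioc _
    _ = ENNReal.ofReal (W * h) := by
        rw [Real.volume_Ioc, ← ENNReal.ofReal_mul hW]
        congr 1; ring

/-- **Slicing along the second coordinate.** [folklore] -/
theorem volume_sublevel_box_le_snd {f : ℝ × ℝ → ℝ} (hf : Continuous f) {a b h s W : ℝ} (hW : 0 ≤ W)
    (hslice : ∀ θ ∈ Ioc a (a + h), volume {φ ∈ Ioc b (b + h) | |f (θ, φ)| < s} ≤ ENNReal.ofReal W) :
    volume ({z : ℝ × ℝ | |f z| < s} ∩ Ioc a (a + h) ×ˢ Ioc b (b + h)) ≤ ENNReal.ofReal (W * h) := by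
  have hT := measurableSet_sublevel_box hf s a b h
  rw [show (volume : Measure (ℝ × ℝ)) = (volume : Measure ℝ).prod volume from rfl,
    Measure.prod_apply hT]
  have hpt : ∀ θ : ℝ, volume (Prod.mk θ ⁻¹' ({z : ℝ × ℝ | |f z| < s} ∩ Ioc a (a + h) ×ˢ Ioc b (b + h))) ≤
      (Ioc a (a + h)).indicator (fun _ => ENNReal.ofReal W) θ := by
    intro θ
    by_cases hθ : θ ∈ Ioc a (a + h)
    · rw [indicator_of_mem hθ]
      refine le_trans (measure_mono fun φ hφ => ?_) (hslice θ hθ)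
      simp only [mem_preimage, mem_inter_iff, mem_setOf_eq, mem_prod] at hφ
      exact ⟨hφ.2.2, hφ.1⟩
    · rw [indicator_of_notMem hθ]
      have : Prod.mk θ ⁻¹' ({z : ℝ × ℝ | |f z| < s} ∩ Ioc a (a + h) ×ˢ Ioc b (b + h)) = ∅ := by
        ext φ
        simp only [mem_preimage, mem_inter_iff, mem_setOf_eq, mem_prod, mem_empty_iff_false, iff_false, not_and]
        exact fun _ h' => absurd h' hθ
      rw [this, measure_empty]
  calc ∫⁻ θ, volume (Prod.mk θ ⁻¹' ({z : ℝ × ℝ | |f z| < s} ∩ Ioc a (a + h) ×ˢ Ioc b (b + h)))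
      ≤ ∫⁻ θ, (Ioc a (a + h)).indicator (fun _ => ENNReal.ofReal W) θ := lintegral_mono hpt
    _ = ENNReal.ofReal W * volume (Ioc a (a + h)) := lintegral_indicator_const measurableSet_Ioc _
    _ = ENNReal.ofReal (W * h) := by
        rw [Real.volume_Ioc, ← ENNReal.ofReal_mul hW]
        congr 1; ring

/-- **Slicing along the diagonal**: if every diagonal slice `u ↦ f(w + u, u)` has sublevel set of
measure `≤ W` on `{u | w + u ∈ (a, a+h], u ∈ (b, b+h]}`, the planar sublevel set in the box has
measure `≤ 2 W h` (the shear `(w, u) ↦ (w + u, u)` preserves Lebesgue measure and the box meets the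
line `θ - φ = w` only for `w ∈ (a - b - h, a - b + h)`). [folklore] -/
theorem volume_sublevel_box_le_diag {f : ℝ × ℝ → ℝ} (hf : Continuous f) {a b h s W : ℝ} (hW : 0 ≤ W)
    (hslice : ∀ w : ℝ, volume {u : ℝ | (w + u ∈ Ioc a (a + h) ∧ u ∈ Ioc b (b + h)) ∧ |f (w + u, u)| < s} ≤
      ENNReal.ofReal W) :
    volume ({z : ℝ × ℝ | |f z| < s} ∩ Ioc a (a + h) ×ˢ Ioc b (b + h)) ≤ ENNReal.ofReal (W * (2 * h)) := by
  have hT := measurableSet_sublevel_box hf s a b h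
  set T : Set (ℝ × ℝ) := {z : ℝ × ℝ | |f z| < s} ∩ Ioc a (a + h) ×ˢ Ioc b (b + h) with hTdef
  have hmp : MeasurePreserving (fun z : ℝ × ℝ => (z.1 + z.2, z.2)) ((volume : Measure ℝ).prod volume)
      ((volume : Measure ℝ).prod volume) := measurePreserving_add_prod volume volume
  have hvol : (volume : Measure (ℝ × ℝ)) = (volume : Measure ℝ).prod volume := rfl
  have hAm : Measurable fun z : ℝ × ℝ => (z.1 + z.2, z.2) := hmp.measurable
  rw [hvol, ← hmp.measure_preimage hT.nullMeasurableSet, Measure.prod_apply (hAm hT)]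
  have hpt : ∀ w : ℝ, volume (Prod.mk w ⁻¹' ((fun z : ℝ × ℝ => (z.1 + z.2, z.2)) ⁻¹' T)) ≤
      (Ioo (a - b - h) (a - b + h)).indicator (fun _ => ENNReal.ofReal W) w := by
    intro w
    have hset : Prod.mk w ⁻¹' ((fun z : ℝ × ℝ => (z.1 + z.2, z.2)) ⁻¹' T) =
        {u : ℝ | (w + u ∈ Ioc a (a + h) ∧ u ∈ Ioc b (b + h)) ∧ |f (w + u, u)| < s} := by
      ext u
      simp only [hTdef, mem_preimage, mem_inter_iff, mem_setOf_eq, mem_prod]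
      tauto
    rw [hset]
    by_cases hw : w ∈ Ioo (a - b - h) (a - b + h)
    · rw [indicator_of_mem hw]; exact hslice w
    · rw [indicator_of_notMem hw]
      have : {u : ℝ | (w + u ∈ Ioc a (a + h) ∧ u ∈ Ioc b (b + h)) ∧ |f (w + u, u)| < s} = ∅ := by
        ext u
        simp only [mem_setOf_eq, mem_Ioc, mem_empty_iff_false, iff_false, not_and]
        intro h1 _
        exact absurd (show w ∈ Ioo (a - b - h) (a - b + h) from
          ⟨by linarith [h1.1.1, h1.2.2], by linarith [h1.1.2, h1.2.1]⟩) hw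
      rw [this, measure_empty]
  calc ∫⁻ w, volume (Prod.mk w ⁻¹' ((fun z : ℝ × ℝ => (z.1 + z.2, z.2)) ⁻¹' T))
      ≤ ∫⁻ w, (Ioo (a - b - h) (a - b + h)).indicator (fun _ => ENNReal.ofReal W) w := lintegral_mono hpt
    _ = ENNReal.ofReal W * volume (Ioo (a - b - h) (a - b + h)) := lintegral_indicator_const measurableSet_Ioo _
    _ = ENNReal.ofReal (W * (2 * h)) := by
        rw [Real.volume_Ioo, ← ENNReal.ofReal_mul hW]
        congr 1; ring

/-- **The grid covers the period**: for `h > 0` and `N h ≥ 2π`, every `x ∈ (-π, π]` lies in a cell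
`(-π + ih, -π + ih + h]` with `i < N`. [folklore] -/
theorem exists_mem_Ioc_grid {h : ℝ} (hh : 0 < h) {N : ℕ} (hN : 2 * π ≤ N * h) {x : ℝ} (hx : x ∈ Ioc (-π) π) :
    ∃ i : ℕ, i < N ∧ x ∈ Ioc (-π + i * h) (-π + i * h + h) := by
  set t : ℝ := (x + π) / h with ht
  have ht0 : 0 < t := div_pos (by linarith [hx.1]) hh
  set k : ℕ := ⌈t⌉₊ with hk
  have hk1 : 1 ≤ k := Nat.one_le_iff_ne_zero.2 (Nat.pos_iff_ne_zero.1 (Nat.ceil_pos.2 ht0))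
  have hkt : t ≤ k := Nat.le_ceil t
  have hkt' : (k : ℝ) < t + 1 := Nat.ceil_lt_add_one ht0.le
  have hkN : k ≤ N := by
    rw [hk]
    refine Nat.ceil_le.2 ?_
    rw [ht, div_le_iff₀ hh]
    linarith [hx.2]
  refine ⟨k - 1, by omega, ?_, ?_⟩
  · have hcast : ((k - 1 : ℕ) : ℝ) = (k : ℝ) - 1 := by rw [Nat.cast_sub hk1, Nat.cast_one]
    rw [hcast]
    have : ((k : ℝ) - 1) * h < x + π := by
      have h1 : ((k : ℝ) - 1) < t := by linarith
      have := (lt_div_iff₀ hh).1 (ht ▸ h1)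
      linarith
    linarith
  · have hcast : ((k - 1 : ℕ) : ℝ) = (k : ℝ) - 1 := by rw [Nat.cast_sub hk1, Nat.cast_one]
    rw [hcast]
    have : x + π ≤ (k : ℝ) * h := by
      have := (div_le_iff₀ hh).1 (show (x + π) / h ≤ k from ht ▸ hkt)
      linarith
    linarith

end Literature.Analysis.Fourier

end
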